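import Mathlib
import HarnessLib
import Summits.HubbardSuperconductivity.HubbardSuperconductivity.Theorems.KLProgrammeKLRegimeEngineV8E5WitnessLevels
import Summits.HubbardSuperconductivity.HubbardSuperconductivity.Theorems.KLProgrammeKLRegimeEngineV8E5WitnessStep
import Summits.HubbardSuperconductivity.HubbardSuperconductivity.Theorems.KLProgrammeKLRegimeEngineV8E5SoftLineSharp
import Summits.HubbardSuperconductivity.HubbardSuperconductivity.Theorems.KLProgrammeKLRegimeEngineV8DefsU10
import Summits.HubbardSuperconductivity.HubbardSuperconductivity.Theorems.KLProgrammeKLRegimeEngineV8DefsL4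

/-!
# Route `KLProgramme` — ENGINE child gen 8 (stmt-HubbardSuperconductivity-20437 `KLRegimeEngineV17F2`), SKELETON v2 class #3, PROVING side:
# the `∃ (C,u)` from ROW SUMS · DRESSING SMALLNESS · ONE CARRIER LAW only — every Gram datum and the envelope DISCHARGED by name
# (cell gate-hubbard-kl, seat p5 g9; assembly part 6; composes `…E5WitnessStep` §5, `…E5WitnessLevels` §7, k3c2-p2's `gram_softShaped_bgmFat_sharp_klEng`)

THE POINT.  The RESCALED dressed slice derivative `λ·ċ_Λ` (`λ = Λ_{n−1} − Λ_n = 3Λ_n ≤ 3Λ`, `‖ċ_Λ‖ ≤ 4‖ṡ_Λ‖` under the dressing smallness,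
`‖ṡ_Λ‖ ≤ (64/3)/Λ · βL²/√(ω²+e_K²)` from `klws_abs_deriv_cutoffWeight_scale_le`) is SOFT-SHAPED with `A_p = 256`, and the dressed soft line is
soft-shaped with `A_p = 8` (`norm_klE5SoftLineSym_le_div_radius`).  Hence ONE instance of k3c2-p2's `gram_softShaped_bgmFat_sharp_klEng` on the fat
family of level `n−2` delivers BOTH Gram half-norms (`κ₀² = 256·Cκ·e₀·8^{−(n−2)}`, `κ₁² = δ = 8·Cκ·e₀·8^{−(n−2)}`) and the soft-line entries, with ONE
constant `Cκ`; the Gram base of the envelope is `264·Cκ·e₀·8^{−(n−2)}`, so the smallness line of `…E5WitnessLevels` reads `264·Cκ·e₀·Θ·(Klam U) ≤ ½` —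
an `n`-FREE coupling threshold `u₀ = 1/(528·Cκ·e₀·Θ·max(Klam,1))`, chosen HERE.  What the suppliers still provide per step `n ≥ 3` is therefore only:
(L1) the ROW/COLUMN sums `α` of the rescaled line-`0` on the fat family with `α ≤ λ·Cα·ε⁻¹·16^n/e₀²`; (SM) the dressing smallness at `Λ_n` and `Λ`;
(RA) the carrier's levelled-norm law (`…E5WitnessLevels` shape, table `C₀Θ^p`, gain on every degree, odd `0`); and for `n ≤ 2` the trivial-family data.

* §9 `norm_klE5SliceSymDeriv_le_div_radius`, `norm_scaled_klE5DerivLineSym_le_div_radius` (soft shape of `λ·ċ_Λ`, `A_p = 256`, for `0 < Λ`, `0 ≤ λ ≤ 3Λ`);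
* §10 **`exists_e5Pkg2_of_stepDataRows`** / **`e5ShareStep2_klE5Raise2_of_stepDataRows`** — the `∃ (C, u)` of record and the step for the deferred pair
  from (L1) + (SM) + (RA) (+ the first steps' trivial data), `P.WF`, `R.WF2`, `0 ≤ Cα`, `0 ≤ C₀`, `1 ≤ Θ`, `C₀²Θ⁵/64 ≤ CA`, `0 ≤ P.Klam`.

Pure composition; no definitions, no named facts, nothing about the model's sizes is asserted; nothing asserts superconductivity.
-/

noncomputable section

namespace Summit.HubbardSuperconductivity.HubbardSuperconductivity.Theorems.KLRegimeSplit

set_option linter.dupNamespace false -- summit = problem name (single-conjunct summit), D-0017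

open Real Finset Literature.MathematicalPhysics.QuantumLattice Literature.Probability.LatticeModels GrassmannAlgebra Matrix
open Literature.MathematicalPhysics.QuantumLattice.FermiRG
open Summit.HubbardSuperconductivity.HubbardSuperconductivity.Theorems.KLProgrammeLegKernels
open Summit.HubbardSuperconductivity.HubbardSuperconductivity.Theorems.KLRegimeWick
open Summit.HubbardSuperconductivity.HubbardSuperconductivity.Theorems.EngineV8
open Summit.HubbardSuperconductivity.HubbardSuperconductivity.Theorems.TwoPointAssembly
open Summit.HubbardSuperconductivity.HubbardSuperconductivity.Theorems.TorusFourierL2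
open Summit.HubbardSuperconductivity.HubbardSuperconductivity.Theorems.DispersionFlow

/-! ## §9 The rescaled dressed slice derivative is soft-shaped -/

section SoftShape

variable {L M : ℕ} (β μ : ℝ) (K : TrigPolyC4v) (n₀ : ℕ) (κ : FreqMomentum L M × Fin 2 → ℂ)

/-- **The slice-derivative symbol is soft-shaped**: `‖ṡ_Λ(ks)‖ ≤ (64/3)/|Λ| · βL²/√(ω² + e_K²)` (`0 ≤ β`, `Λ ≠ 0`). [folklore] -/
theorem norm_klE5SliceSymDeriv_le_div_radius (hβ : 0 ≤ β) {Λ : ℝ} (hΛ : Λ ≠ 0) (ks : FreqMomentum L M × Fin 2) :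
    ‖klE5SliceSymDeriv L M β μ K Λ ks‖ ≤
      64 / 3 / |Λ| * (β * (L : ℝ) ^ 2) / Real.sqrt (matsubaraFreq β M ks.1.1 ^ 2 + nambuXiCT L μ K ks.1.2 ^ 2) := by
  set ω : ℝ := matsubaraFreq β M ks.1.1 with hω
  set ξ : ℝ := nambuXiCT L μ K ks.1.2 with hξ
  have hw : ‖((deriv (fun Λ' : ℝ => hubbardCutoffWeightCT L M β μ K Λ' ks.1) Λ : ℝ) : ℂ)‖ ≤ 64 / 3 / |Λ| := by
    rw [Complex.norm_real, Real.norm_eq_abs]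
    exact klws_abs_deriv_cutoffWeight_scale_le L M β μ K hΛ ks.1
  have hden : (nambuDenCT L M β μ 0 K ks.1 : ℝ) = ω ^ 2 + ξ ^ 2 := by rw [nambuDenCT_zero_seed]
  have hsym : ‖(Complex.I * (ω : ℂ) + (ξ : ℂ)) / ((nambuDenCT L M β μ 0 K ks.1 : ℝ) : ℂ)‖ = 1 / Real.sqrt (ω ^ 2 + ξ ^ 2) := by
    rw [hden]; exact norm_I_mul_add_div' ω ξ
  have hβL : ‖(((β * (L : ℝ) ^ 2 : ℝ)) : ℂ)‖ = β * (L : ℝ) ^ 2 := by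
    rw [Complex.norm_real, Real.norm_eq_abs, abs_of_nonneg (by positivity)]
  have hs0 : 0 ≤ 1 / Real.sqrt (ω ^ 2 + ξ ^ 2) := by positivity
  unfold klE5SliceSymDeriv
  calc ‖((deriv (fun Λ' : ℝ => hubbardCutoffWeightCT L M β μ K Λ' ks.1) Λ : ℝ) : ℂ) *
          (((β * (L : ℝ) ^ 2 : ℝ) : ℂ) * ((Complex.I * (ω : ℂ) + (ξ : ℂ)) / ((nambuDenCT L M β μ 0 K ks.1 : ℝ) : ℂ)))‖
      = ‖((deriv (fun Λ' : ℝ => hubbardCutoffWeightCT L M β μ K Λ' ks.1) Λ : ℝ) : ℂ)‖ * ((β * (L : ℝ) ^ 2) * (1 / Real.sqrt (ω ^ 2 + ξ ^ 2))) := by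
        rw [norm_mul, norm_mul, hβL, hsym]
    _ ≤ 64 / 3 / |Λ| * ((β * (L : ℝ) ^ 2) * (1 / Real.sqrt (ω ^ 2 + ξ ^ 2))) :=
        mul_le_mul_of_nonneg_right hw (mul_nonneg (by positivity) hs0)
    _ = 64 / 3 / |Λ| * (β * (L : ℝ) ^ 2) / Real.sqrt (ω ^ 2 + ξ ^ 2) := by ring

/-- **The RESCALED dressed slice derivative is soft-shaped with `A_p = 256`**: for `0 < Λ`, `0 ≤ λ ≤ 3Λ` and the dressing smallness `‖s_Λ(ks)κ(ks)‖ ≤ ½`,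
`‖λ·ċ_Λ(ks)‖ ≤ 256·βL²/√(ω² + e_K²)` (`‖ċ_Λ‖ ≤ 4‖ṡ_Λ‖`, `‖ṡ_Λ‖ ≤ (64/3)/Λ·βL²/√…`, `λ·4·(64/3)/Λ ≤ 256`). [folklore] -/
theorem norm_scaled_klE5DerivLineSym_le_div_radius (hβ : 0 ≤ β) {Λ lam : ℝ} (hΛ : 0 < Λ) (hlam0 : 0 ≤ lam) (hlam : lam ≤ 3 * Λ)
    (ks : FreqMomentum L M × Fin 2) (h : ‖klE5SliceSym L M β μ K n₀ Λ ks * κ ks‖ ≤ 1 / 2) :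
    ‖(lam : ℂ) * klE5DerivLineSym L M β μ K n₀ κ Λ ks‖ ≤
      256 * (β * (L : ℝ) ^ 2) / Real.sqrt (matsubaraFreq β M ks.1.1 ^ 2 + nambuXiCT L μ K ks.1.2 ^ 2) := by
  have h1 := norm_klE5DerivLineSym_le β μ K n₀ κ ks h
  have h2 := norm_klE5SliceSymDeriv_le_div_radius (L := L) (M := M) β μ K hβ hΛ.ne' ks
  rw [abs_of_pos hΛ] at h2
  set X : ℝ := β * (L : ℝ) ^ 2 / Real.sqrt (matsubaraFreq β M ks.1.1 ^ 2 + nambuXiCT L μ K ks.1.2 ^ 2) with hX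
  have hX0 : 0 ≤ X := by positivity
  rw [norm_mul, Complex.norm_real, Real.norm_of_nonneg hlam0]
  calc lam * ‖klE5DerivLineSym L M β μ K n₀ κ Λ ks‖
      ≤ (3 * Λ) * (4 * (64 / 3 / Λ * (β * (L : ℝ) ^ 2) / Real.sqrt (matsubaraFreq β M ks.1.1 ^ 2 + nambuXiCT L μ K ks.1.2 ^ 2))) :=
        mul_le_mul hlam (h1.trans (mul_le_mul_of_nonneg_left h2 (by norm_num))) (norm_nonneg _) (by positivity)
    _ = 256 * (β * (L : ℝ) ^ 2) / Real.sqrt (matsubaraFreq β M ks.1.1 ^ 2 + nambuXiCT L μ K ks.1.2 ^ 2) := by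
        field_simp
        ring

end SoftShape

/-! ## §10 The `∃ (C,u)` from row sums · dressing smallness · one carrier law -/

section Rows

variable (P : SplitConsts) (R : RenConsts) {Cα Cδ C₀ Θ CA : ℝ}

/-- **The class-#3 `∃ (C,u)` from (L1) ROW SUMS, (SM) DRESSING SMALLNESS and (RA) ONE CARRIER LAW** — every Gram half-norm (`κ₀`, `κ₁`), the soft-line
entries (`δ`), the envelope (`x′`, `A`) and its coupling threshold are DISCHARGED inside (k3c2-p2's `gram_softShaped_bgmFat_sharp_klEng` at `A_p = 256` and
`A_p = 8` with ONE constant `Cκ`; `klE5_vertexPackage_of_levelLaw` with Gram base `264·Cκ·e₀·8^{−(n−2)}`; threshold `u₀ = 1/(528·Cκ·e₀·Θ·max(Klam,1))`).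
Per step `n ≥ 3` the hypothesis `h3` asks only: `α` with the row/column-sum bounds and `α ≤ λ·Cα·ε⁻¹·16^n/e₀²`, the smallness at `Λ_n` and `Λ`, the law
(and its odd clause); `h12` = the first steps' trivial-family data. [cite: BenfattoGiulianiMastropietro2006, §2.8 (2.80); Lemma 2.5 (2.98)] -/
theorem exists_e5Pkg2_of_stepDataRows (hP : P.WF) (hR : R.WF2) (hCα : 0 ≤ Cα) (hC₀ : 0 ≤ C₀) (hΘ : 1 ≤ Θ) (hCA : C₀ ^ 2 * Θ ^ 5 / 64 ≤ CA)
    (hKlam : 0 ≤ P.Klam)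
    (h3 : ∃ u : EngConsts → ℝ → ℝ, (∀ Q cc, 0 < u Q cc) ∧
        ∀ G : GeoConsts, G.WF → ∀ Q : EngConsts, (klEngQ7 P R).IsRaiseOf Q →
        ∀ cc : ℝ, 0 < cc → cc ≤ klEngC₃6 P R →
        ∀ μ ∈ klWindowC, ∀ U : ℝ, 0 < U → U ≤ klEngU₀10 P R cc → U ≤ u Q cc →
        ∀ β : ℝ, klBetaMin ≤ β → β ≤ Real.exp (cc / U ^ 2) →
        ∀ (L M : ℕ) [NeZero L] [NeZero M], klEngL₄ P R β U ≤ L → klEngM₃ β U L ≤ M →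
        ∀ n : ℕ, 1 ≤ n → n ≤ nScales β + 1 → IsKLRegime U cc (-(n : ℤ)) →
        HistP klPredsV17F2 L M G P Q R β U μ 0 n →
        FrameOK R U (nScales β) μ (klFlowFrameU L M β U μ n) →
        (∀ j ≤ n, LevelsUExportMixedAt L M (klCU2 P R (klEngQ7 P R)) P β U μ j) →
        ∀ Λ ∈ Set.Icc (klScale klE0 n) (klScale klE0 (n - 1)), ∀ Qm : TorusSite 2 L,
        ∀ x y : TorusSite 2 L × MatsubaraIdx M, x.1 ∈ klBall L μ 0 → y.1 ∈ klBall L μ 0 →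
        3 ≤ n →
        ∃ α : ℝ, 0 ≤ α ∧
          (∀ X, ∑ Y, ‖((sectorSubMatrix L M β (bgmFatMultiplier L M klE0 β (nambuXiCT L μ (klFlowFrameU L M β U μ n)) (n - 2))).transpose *
            normalCovariance L M (fun ks => ((klScale klE0 (n - 1) - klScale klE0 n : ℝ) : ℂ) * klE5DerivLineSym L M β μ (klFlowFrameU L M β U μ n) (n - 1) (klE5Kappa L M β U μ (klFlowFrameU L M β U μ n) (n - 1)) Λ ks) *
            sectorSubMatrix L M β (bgmFatMultiplier L M klE0 β (nambuXiCT L μ (klFlowFrameU L M β U μ n)) (n - 2))) X Y‖ ≤ α) ∧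
          (∀ Y, ∑ X, ‖((sectorSubMatrix L M β (bgmFatMultiplier L M klE0 β (nambuXiCT L μ (klFlowFrameU L M β U μ n)) (n - 2))).transpose *
            normalCovariance L M (fun ks => ((klScale klE0 (n - 1) - klScale klE0 n : ℝ) : ℂ) * klE5DerivLineSym L M β μ (klFlowFrameU L M β U μ n) (n - 1) (klE5Kappa L M β U μ (klFlowFrameU L M β U μ n) (n - 1)) Λ ks) *
            sectorSubMatrix L M β (bgmFatMultiplier L M klE0 β (nambuXiCT L μ (klFlowFrameU L M β U μ n)) (n - 2))) X Y‖ ≤ α) ∧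
          (∀ ks : FreqMomentum L M × Fin 2, ‖klE5SliceSym L M β μ (klFlowFrameU L M β U μ n) (n - 1) (klScale klE0 n) ks * (klE5Kappa L M β U μ (klFlowFrameU L M β U μ n) (n - 1)) ks‖ ≤ 1 / 2 ∧
            ‖klE5SliceSym L M β μ (klFlowFrameU L M β U μ n) (n - 1) Λ ks * (klE5Kappa L M β U μ (klFlowFrameU L M β U μ n) (n - 1)) ks‖ ≤ 1 / 2) ∧
          (∀ m : ℕ, 4 ≤ m → Even m → ∀ Ωe : Fin m → Option (SectorLeg (sectorCount (n - 2) + 4)),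
            hubbardSectorKernelNorm L M β (pointAugment (klAnisoFamily L M β μ (klFlowFrameU L M β U μ n) klE0 (n - 2)) (klE5ExtMomenta Qm x y)) (prescribedTuples univ Ωe) (klE5Carrier L M β μ (klFlowFrameU L M β U μ n) (n - 1) (klE5Kappa L M β U μ (klFlowFrameU L M β U μ n) (n - 1)) (klE5Input L M β U μ (klFlowFrameU L M β U μ n) (n - 1)) Λ) ≤
              C₀ * Θ ^ (m / 2) * (P.Klam * U) ^ (m / 2 - 1) * (2 : ℝ) ^ ((3 * (m / 2) - 5) * (n - 2)) *
                (((2 : ℝ) ^ (n - 2))⁻¹) ^ levelGainExp (levelCount Ωe)) ∧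
          (∀ m : ℕ, ¬ Even m → ∀ Ωe : Fin m → Option (SectorLeg (sectorCount (n - 2) + 4)),
            hubbardSectorKernelNorm L M β (pointAugment (klAnisoFamily L M β μ (klFlowFrameU L M β U μ n) klE0 (n - 2)) (klE5ExtMomenta Qm x y)) (prescribedTuples univ Ωe) (klE5Carrier L M β μ (klFlowFrameU L M β U μ n) (n - 1) (klE5Kappa L M β U μ (klFlowFrameU L M β U μ n) (n - 1)) (klE5Input L M β U μ (klFlowFrameU L M β U μ n) (n - 1)) Λ) ≤ 0) ∧
          α ≤ (klScale klE0 (n - 1) - klScale klE0 n) * (Cα * (imagTimeWeight β M)⁻¹ * (16 : ℝ) ^ n / klE0 ^ 2))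
    (h12 : ∃ u : EngConsts → ℝ → ℝ, (∀ Q cc, 0 < u Q cc) ∧
        ∀ G : GeoConsts, G.WF → ∀ Q : EngConsts, (klEngQ7 P R).IsRaiseOf Q →
        ∀ cc : ℝ, 0 < cc → cc ≤ klEngC₃6 P R →
        ∀ μ ∈ klWindowC, ∀ U : ℝ, 0 < U → U ≤ klEngU₀10 P R cc → U ≤ u Q cc →
        ∀ β : ℝ, klBetaMin ≤ β → β ≤ Real.exp (cc / U ^ 2) →
        ∀ (L M : ℕ) [NeZero L] [NeZero M], klEngL₄ P R β U ≤ L → klEngM₃ β U L ≤ M →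
        ∀ n : ℕ, 1 ≤ n → n ≤ nScales β + 1 → IsKLRegime U cc (-(n : ℤ)) →
        HistP klPredsV17F2 L M G P Q R β U μ 0 n →
        FrameOK R U (nScales β) μ (klFlowFrameU L M β U μ n) →
        (∀ j ≤ n, LevelsUExportMixedAt L M (klCU2 P R (klEngQ7 P R)) P β U μ j) →
        ∀ Λ ∈ Set.Icc (klScale klE0 n) (klScale klE0 (n - 1)), ∀ Qm : TorusSite 2 L,
        ∀ x y : TorusSite 2 L × MatsubaraIdx M, x.1 ∈ klBall L μ 0 → y.1 ∈ klBall L μ 0 →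
        n ≤ 2 →
        ∃ (α κ₀ δ κ₁ x' A : ℝ) (Nf Ne : ℕ → ℕ → ℝ), 0 ≤ α ∧ 0 ≤ κ₀ ∧ 0 ≤ δ ∧ 0 ≤ κ₁ ∧
          (∀ X, ∑ Y, ‖((sectorSubMatrix L M β (trivialMultiplier L M)).transpose *
            normalCovariance L M (fun ks => ((klScale klE0 (n - 1) - klScale klE0 n : ℝ) : ℂ) * klE5DerivLineSym L M β μ (klFlowFrameU L M β U μ n) (n - 1) (klE5Kappa L M β U μ (klFlowFrameU L M β U μ n) (n - 1)) Λ ks) *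
            sectorSubMatrix L M β (trivialMultiplier L M)) X Y‖ ≤ α) ∧
          (∀ Y, ∑ X, ‖((sectorSubMatrix L M β (trivialMultiplier L M)).transpose *
            normalCovariance L M (fun ks => ((klScale klE0 (n - 1) - klScale klE0 n : ℝ) : ℂ) * klE5DerivLineSym L M β μ (klFlowFrameU L M β U μ n) (n - 1) (klE5Kappa L M β U μ (klFlowFrameU L M β U μ n) (n - 1)) Λ ks) *
            sectorSubMatrix L M β (trivialMultiplier L M)) X Y‖ ≤ α) ∧
          (∀ Y : SpaceTimeIdx L M × SectorLeg 1, Y.2.2 = 0 →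
            ‖sectorGramF L M β (trivialMultiplier L M) (fun ks => ((klScale klE0 (n - 1) - klScale klE0 n : ℝ) : ℂ) * klE5DerivLineSym L M β μ (klFlowFrameU L M β U μ n) (n - 1) (klE5Kappa L M β U μ (klFlowFrameU L M β U μ n) (n - 1)) Λ ks) Y‖ ≤ κ₀) ∧
          (∀ Y : SpaceTimeIdx L M × SectorLeg 1, Y.2.2 = 1 →
            ‖sectorGramG L M β (trivialMultiplier L M) (fun ks => ((klScale klE0 (n - 1) - klScale klE0 n : ℝ) : ℂ) * klE5DerivLineSym L M β μ (klFlowFrameU L M β U μ n) (n - 1) (klE5Kappa L M β U μ (klFlowFrameU L M β U μ n) (n - 1)) Λ ks) Y‖ ≤ κ₀) ∧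
          (∀ X Y, ‖((sectorSubMatrix L M β (trivialMultiplier L M)).transpose * normalCovariance L M (klE5SoftLineSym L M β μ (klFlowFrameU L M β U μ n) (n - 1) (klE5Kappa L M β U μ (klFlowFrameU L M β U μ n) (n - 1)) Λ) *
            sectorSubMatrix L M β (trivialMultiplier L M)) X Y‖ ≤ δ) ∧
          (∀ Y : SpaceTimeIdx L M × SectorLeg 1, Y.2.2 = 0 → ‖sectorGramF L M β (trivialMultiplier L M) (klE5SoftLineSym L M β μ (klFlowFrameU L M β U μ n) (n - 1) (klE5Kappa L M β U μ (klFlowFrameU L M β U μ n) (n - 1)) Λ) Y‖ ≤ κ₁) ∧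
          (∀ Y : SpaceTimeIdx L M × SectorLeg 1, Y.2.2 = 1 → ‖sectorGramG L M β (trivialMultiplier L M) (klE5SoftLineSym L M β μ (klFlowFrameU L M β U μ n) (n - 1) (klE5Kappa L M β U μ (klFlowFrameU L M β U μ n) (n - 1)) Λ) Y‖ ≤ κ₁) ∧
          (∀ k q, 0 ≤ Ne k q) ∧
          (∀ k ∈ Icc 3 (Fintype.card (HubbardFieldIdx L M × Fin 2) + 2), ∀ q ≤ 4, ∀ σ : Fin q → SectorLeg 1,
            hubbardSectorKernelNorm L M β (trivialMultiplier L M) (prescribedTuples univ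
              (Fin.append (fun _ : Fin k => (none : Option (SectorLeg 1))) (fun j => some (σ j)))) (klE5Carrier L M β μ (klFlowFrameU L M β U μ n) (n - 1) (klE5Kappa L M β U μ (klFlowFrameU L M β U μ n) (n - 1)) (klE5Input L M β U μ (klFlowFrameU L M β U μ n) (n - 1)) Λ) ≤ Nf k q) ∧
          (∀ k ∈ Icc 3 (Fintype.card (HubbardFieldIdx L M × Fin 2) + 2), ∀ q ≤ 4, ∀ (τ : Fin 3 → SectorLeg 1) (σ : Fin q → SectorLeg 1),
            hubbardSectorKernelNorm L M β (trivialMultiplier L M) (prescribedTuples univ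
              (Fin.append (fun i : Fin k => if h : (i : ℕ) < 3 then some (τ ⟨i, h⟩) else none) (fun j => some (σ j))))
              (klE5Carrier L M β μ (klFlowFrameU L M β U μ n) (n - 1) (klE5Kappa L M β U μ (klFlowFrameU L M β U μ n) (n - 1)) (klE5Input L M β U μ (klFlowFrameU L M β U μ n) (n - 1)) Λ) ≤ Ne k q) ∧
          0 ≤ x' ∧ x' ≤ 1 / 2 ∧ 0 ≤ A ∧
          (∀ q ∈ Icc 1 4, ∀ k ∈ Icc 3 (Fintype.card (HubbardFieldIdx L M × Fin 2) + 2),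
            (κ₀ ^ 2 + κ₁ ^ 2) ^ (k - 3) * ((imagTimeWeight β M * Nf k q) * (imagTimeWeight β M * Ne k (4 - q))) ≤ x' ^ (k - 3) * A) ∧
          α ≤ (klScale klE0 (n - 1) - klScale klE0 n) * (Cα * (imagTimeWeight β M)⁻¹ * (16 : ℝ) ^ n / klE0 ^ 2) ∧
          δ ≤ Cδ * klE0 * ((8 : ℝ) ^ n)⁻¹ ∧ A ≤ CA * imagTimeWeight β M ^ 2 * (P.Klam * U) ^ 3 * (8 : ℝ) ^ n) :
    ∃ e : ℝ × (EngConsts → ℝ → ℝ), IsE5Pkg2 e ∧ E5ShareStep2 P R e.1 e.2 := by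
  obtain ⟨Cκ, hCκ, hGram⟩ := gram_softShaped_bgmFat_sharp_klEng
  obtain ⟨u3, hu3, h3⟩ := h3
  obtain ⟨u12, hu12, h12⟩ := h12
  have he₀ : (0 : ℝ) < klE0 := by norm_num [klE0]
  have hΘ0 : 0 < Θ := zero_lt_one.trans_le hΘ
  have hmax : 0 < max P.Klam 1 := lt_max_of_lt_right one_pos
  have hCA0 : 0 ≤ CA := le_trans (by positivity) hCA
  -- the n-free threshold closing the envelope
  set u₀ : ℝ := 1 / (528 * Cκ * klE0 * Θ * max P.Klam 1) with hu₀
  have hu₀pos : 0 < u₀ := by rw [hu₀]; positivity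
  refine exists_e5Pkg2_of_stepData P R (Cα := Cα) (Cδ := max (512 * Cκ) Cδ) (CA := CA) (u := fun Q cc => min (u3 Q cc) (min (u12 Q cc) u₀))
    hCα hCA0 (fun Q cc => lt_min (hu3 Q cc) (lt_min (hu12 Q cc) hu₀pos)) ?_ ?_
  · intro G hG Q hQ cc hcc hcc3 μ hμ U hU hU10 hUu β hβ hβc L M _ _ hL hM n hn hnN hreg hH hF hX Λ hΛ Qm x y hx hy h3n
    have hUu3 : U ≤ u3 Q cc := hUu.trans (min_le_left _ _)
    have hUu₀ : U ≤ u₀ := hUu.trans ((min_le_right _ _).trans (min_le_right _ _))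
    obtain ⟨α, hα, hrow, hcol, hsmall, hlaw, hodd, hαs⟩ :=
      h3 G hG Q hQ cc hcc hcc3 μ hμ U hU hU10 hUu3 β hβ hβc L M hL hM n hn hnN hreg hH hF hX Λ hΛ Qm x y hx hy h3n
    have hβ0 : 0 ≤ β := (pos_of_klBetaMin_le hβ).le
    have hΛ0 : 0 < Λ := lt_of_lt_of_le (by unfold klScale; positivity) hΛ.1
    -- the slice measure `λ = 3Λ_n ≤ 3Λ`
    have hlam : klScale klE0 (n - 1) - klScale klE0 n = 3 * klScale klE0 n := by
      rw [klScale_pred_sub_eq klE0 hn, klScale]; ring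
    have hlam0 : 0 ≤ klScale klE0 (n - 1) - klScale klE0 n := by rw [hlam]; unfold klScale; positivity
    have hlam3 : klScale klE0 (n - 1) - klScale klE0 n ≤ 3 * Λ := by rw [hlam]; exact mul_le_mul_of_nonneg_left hΛ.1 (by norm_num)
    -- the generic sharp Gram lemma at the fat family of level `n−2`, doors threaded
    have hG' := hGram P R cc hP hR hcc (hcc3.trans (klEngC₃6_le_klEngC₃3 P R)) μ hμ U hU (hU10.trans (klEngU₀10_le_klEngU₀4 P R cc)) β hβ hβc
      (klFlowFrameU L M β U μ n) hF L M ((klEngL₃_le_klEngL₄ P R β U).trans hL) hM (n - 2) (by omega) (by omega)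
    -- line 0 (rescaled dressed derivative): `A_p = 256`
    obtain ⟨-, -, hκF₀, hκG₀⟩ := hG' (fun ks => ((klScale klE0 (n - 1) - klScale klE0 n : ℝ) : ℂ) *
        klE5DerivLineSym L M β μ (klFlowFrameU L M β U μ n) (n - 1) (klE5Kappa L M β U μ (klFlowFrameU L M β U μ n) (n - 1)) Λ ks) 256 (by norm_num)
      (fun ks _ => norm_scaled_klE5DerivLineSym_le_div_radius β μ (klFlowFrameU L M β U μ n) (n - 1) _ hβ0 hΛ0 hlam0 hlam3 ks (hsmall ks).2)
    -- line 1 (dressed soft line): `A_p = 8`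
    have hsmall' : ∀ ks : FreqMomentum L M × Fin 2,
        ‖klE5SliceSym L M β μ (klFlowFrameU L M β U μ n) (n - 1) (klScale klE0 (n - 1 + 1)) ks * klE5Kappa L M β U μ (klFlowFrameU L M β U μ n) (n - 1) ks‖ ≤ 1 / 2 := by
      rw [Nat.sub_add_cancel hn]; exact fun ks => (hsmall ks).1
    obtain ⟨hent, -, hκF₁, hκG₁⟩ := hG' (klE5SoftLineSym L M β μ (klFlowFrameU L M β U μ n) (n - 1) (klE5Kappa L M β U μ (klFlowFrameU L M β U μ n) (n - 1)) Λ)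
      8 (by norm_num) (fun ks _ => norm_klE5SoftLineSym_le_div_radius (L := L) (M := M) β μ (klFlowFrameU L M β U μ n) (n - 1) _ hβ0 ks (hsmall' ks) (hsmall ks).2)
    -- the vertex package from the law, Gram base `264·Cκ·e₀·8^{−(n−2)}`
    have hg : 0 ≤ P.Klam * U := mul_nonneg hKlam hU.le
    have hκs0 : (0 : ℝ) ≤ 264 * Cκ * (klE0 * ((8 : ℝ) ^ (n - 2))⁻¹) := by positivity
    have hsm : 264 * Cκ * (klE0 * ((8 : ℝ) ^ (n - 2))⁻¹) * Θ * (P.Klam * U) * (8 : ℝ) ^ (n - 2) ≤ 1 / 2 := by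
      have h8 : (8 : ℝ) ^ (n - 2) ≠ 0 := pow_ne_zero _ (by norm_num)
      have e : 264 * Cκ * (klE0 * ((8 : ℝ) ^ (n - 2))⁻¹) * Θ * (P.Klam * U) * (8 : ℝ) ^ (n - 2) = 264 * Cκ * klE0 * Θ * (P.Klam * U) := by
        field_simp
      rw [e]
      have hKU : P.Klam * U ≤ max P.Klam 1 * u₀ := mul_le_mul (le_max_left _ _) hUu₀ hU.le hmax.le
      have h2 : 264 * Cκ * klE0 * Θ * (max P.Klam 1 * u₀) = 1 / 2 := by
        rw [hu₀]; field_simp; ring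
      calc 264 * Cκ * klE0 * Θ * (P.Klam * U) ≤ 264 * Cκ * klE0 * Θ * (max P.Klam 1 * u₀) :=
            mul_le_mul_of_nonneg_left hKU (by positivity)
        _ = 1 / 2 := h2
    obtain ⟨Nf, Ne, x', A, hNe0, hNf, hNe, hx0, hx1, hA, henv, hAs⟩ :=
      klE5_vertexPackage_of_levelLaw β (pointAugment (klAnisoFamily L M β μ (klFlowFrameU L M β U μ n) klE0 (n - 2)) (klE5ExtMomenta Qm x y))
        (klE5Carrier L M β μ (klFlowFrameU L M β U μ n) (n - 1) (klE5Kappa L M β U μ (klFlowFrameU L M β U μ n) (n - 1)) (klE5Input L M β U μ (klFlowFrameU L M β U μ n) (n - 1)) Λ) (show 2 ≤ n by omega) hg hC₀ hΘ hκs0 hlaw hodd hsm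
    have hbase : Real.sqrt (256 * Cκ * (klE0 * ((8 : ℝ) ^ (n - 2))⁻¹)) ^ 2 + Real.sqrt (8 * Cκ * (klE0 * ((8 : ℝ) ^ (n - 2))⁻¹)) ^ 2 =
        264 * Cκ * (klE0 * ((8 : ℝ) ^ (n - 2))⁻¹) := by
      rw [Real.sq_sqrt (by positivity), Real.sq_sqrt (by positivity)]; ring
    refine ⟨α, Real.sqrt (256 * Cκ * (klE0 * ((8 : ℝ) ^ (n - 2))⁻¹)), 8 * Cκ * (klE0 * ((8 : ℝ) ^ (n - 2))⁻¹),
      Real.sqrt (8 * Cκ * (klE0 * ((8 : ℝ) ^ (n - 2))⁻¹)), x', A, Nf, Ne, hα, Real.sqrt_nonneg _, by positivity, Real.sqrt_nonneg _,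
      hrow, hcol, fun Y _ => hκF₀ Y, fun Y _ => hκG₀ Y, hent, fun Y _ => hκF₁ Y, fun Y _ => hκG₁ Y, hNe0, hNf, hNe, hx0, hx1, hA, ?_, hαs, ?_,
      hAs.trans ?_⟩
    · intro q hq k hk
      rw [hbase]
      exact henv q hq k hk
    · -- `8·Cκ·e₀·8^{−(n−2)} = 512·Cκ·e₀·8^{−n} ≤ max(512·Cκ, Cδ)·e₀·8^{−n}`
      have h8 : ((8 : ℝ) ^ (n - 2))⁻¹ = 64 * ((8 : ℝ) ^ n)⁻¹ := by
        have e : (8 : ℝ) ^ n = (8 : ℝ) ^ (n - 2) * 64 := by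
          rw [show (64 : ℝ) = 8 ^ 2 by norm_num, ← pow_add, Nat.sub_add_cancel (by omega : 2 ≤ n)]
        have h0 : (8 : ℝ) ^ (n - 2) ≠ 0 := pow_ne_zero _ (by norm_num)
        rw [e, mul_inv]
        field_simp
      rw [h8]
      have h1 : 8 * Cκ * (klE0 * (64 * ((8 : ℝ) ^ n)⁻¹)) = (512 * Cκ) * klE0 * ((8 : ℝ) ^ n)⁻¹ := by ring
      rw [h1]
      exact mul_le_mul_of_nonneg_right (mul_le_mul_of_nonneg_right (le_max_left _ _) he₀.le) (by positivity)
    · exact mul_le_mul_of_nonneg_right (mul_le_mul_of_nonneg_right (mul_le_mul_of_nonneg_right hCA (sq_nonneg _)) (pow_nonneg hg 3)) (by positivity)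
  · intro G hG Q hQ cc hcc hcc3 μ hμ U hU hU10 hUu β hβ hβc L M _ _ hL hM n hn hnN hreg hH hF hX Λ hΛ Qm x y hx hy h12n
    obtain ⟨α, κ₀, δ, κ₁, x', A, Nf, Ne, hα, hκ₀, hδ, hκ₁, hrow, hcol, hκF₀, hκG₀, hent, hκF₁, hκG₁, hNe0, hNf, hNe, hx0, hx1, hA, henv, hαs, hδs, hAs⟩ :=
      h12 G hG Q hQ cc hcc hcc3 μ hμ U hU hU10 (hUu.trans ((min_le_right _ _).trans (min_le_left _ _))) β hβ hβc L M hL hM n hn hnN hreg hH hF hX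
        Λ hΛ Qm x y hx hy h12n
    refine ⟨α, κ₀, δ, κ₁, x', A, Nf, Ne, hα, hκ₀, hδ, hκ₁, hrow, hcol, hκF₀, hκG₀, hent, hκF₁, hκG₁, hNe0, hNf, hNe, hx0, hx1, hA, henv, hαs,
      hδs.trans ?_, hAs⟩
    exact mul_le_mul_of_nonneg_right (mul_le_mul_of_nonneg_right (le_max_right _ _) he₀.le) (by positivity)

/-- **Hence the successor step for the DEFERRED pair** from row sums · dressing smallness · one carrier law. [cite: BenfattoGiulianiMastropietro2006, §2.8 (2.80)] -/
theorem e5ShareStep2_klE5Raise2_of_stepDataRows (hP : P.WF) (hR : R.WF2) (hCα : 0 ≤ Cα) (hC₀ : 0 ≤ C₀) (hΘ : 1 ≤ Θ) (hCA : C₀ ^ 2 * Θ ^ 5 / 64 ≤ CA)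
    (hKlam : 0 ≤ P.Klam)
    (h3 : ∃ u : EngConsts → ℝ → ℝ, (∀ Q cc, 0 < u Q cc) ∧
        ∀ G : GeoConsts, G.WF → ∀ Q : EngConsts, (klEngQ7 P R).IsRaiseOf Q →
        ∀ cc : ℝ, 0 < cc → cc ≤ klEngC₃6 P R →
        ∀ μ ∈ klWindowC, ∀ U : ℝ, 0 < U → U ≤ klEngU₀10 P R cc → U ≤ u Q cc →
        ∀ β : ℝ, klBetaMin ≤ β → β ≤ Real.exp (cc / U ^ 2) →
        ∀ (L M : ℕ) [NeZero L] [NeZero M], klEngL₄ P R β U ≤ L → klEngM₃ β U L ≤ M →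
        ∀ n : ℕ, 1 ≤ n → n ≤ nScales β + 1 → IsKLRegime U cc (-(n : ℤ)) →
        HistP klPredsV17F2 L M G P Q R β U μ 0 n →
        FrameOK R U (nScales β) μ (klFlowFrameU L M β U μ n) →
        (∀ j ≤ n, LevelsUExportMixedAt L M (klCU2 P R (klEngQ7 P R)) P β U μ j) →
        ∀ Λ ∈ Set.Icc (klScale klE0 n) (klScale klE0 (n - 1)), ∀ Qm : TorusSite 2 L,
        ∀ x y : TorusSite 2 L × MatsubaraIdx M, x.1 ∈ klBall L μ 0 → y.1 ∈ klBall L μ 0 →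
        3 ≤ n →
        ∃ α : ℝ, 0 ≤ α ∧
          (∀ X, ∑ Y, ‖((sectorSubMatrix L M β (bgmFatMultiplier L M klE0 β (nambuXiCT L μ (klFlowFrameU L M β U μ n)) (n - 2))).transpose *
            normalCovariance L M (fun ks => ((klScale klE0 (n - 1) - klScale klE0 n : ℝ) : ℂ) * klE5DerivLineSym L M β μ (klFlowFrameU L M β U μ n) (n - 1) (klE5Kappa L M β U μ (klFlowFrameU L M β U μ n) (n - 1)) Λ ks) *
            sectorSubMatrix L M β (bgmFatMultiplier L M klE0 β (nambuXiCT L μ (klFlowFrameU L M β U μ n)) (n - 2))) X Y‖ ≤ α) ∧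
          (∀ Y, ∑ X, ‖((sectorSubMatrix L M β (bgmFatMultiplier L M klE0 β (nambuXiCT L μ (klFlowFrameU L M β U μ n)) (n - 2))).transpose *
            normalCovariance L M (fun ks => ((klScale klE0 (n - 1) - klScale klE0 n : ℝ) : ℂ) * klE5DerivLineSym L M β μ (klFlowFrameU L M β U μ n) (n - 1) (klE5Kappa L M β U μ (klFlowFrameU L M β U μ n) (n - 1)) Λ ks) *
            sectorSubMatrix L M β (bgmFatMultiplier L M klE0 β (nambuXiCT L μ (klFlowFrameU L M β U μ n)) (n - 2))) X Y‖ ≤ α) ∧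
          (∀ ks : FreqMomentum L M × Fin 2, ‖klE5SliceSym L M β μ (klFlowFrameU L M β U μ n) (n - 1) (klScale klE0 n) ks * (klE5Kappa L M β U μ (klFlowFrameU L M β U μ n) (n - 1)) ks‖ ≤ 1 / 2 ∧
            ‖klE5SliceSym L M β μ (klFlowFrameU L M β U μ n) (n - 1) Λ ks * (klE5Kappa L M β U μ (klFlowFrameU L M β U μ n) (n - 1)) ks‖ ≤ 1 / 2) ∧
          (∀ m : ℕ, 4 ≤ m → Even m → ∀ Ωe : Fin m → Option (SectorLeg (sectorCount (n - 2) + 4)),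
            hubbardSectorKernelNorm L M β (pointAugment (klAnisoFamily L M β μ (klFlowFrameU L M β U μ n) klE0 (n - 2)) (klE5ExtMomenta Qm x y)) (prescribedTuples univ Ωe) (klE5Carrier L M β μ (klFlowFrameU L M β U μ n) (n - 1) (klE5Kappa L M β U μ (klFlowFrameU L M β U μ n) (n - 1)) (klE5Input L M β U μ (klFlowFrameU L M β U μ n) (n - 1)) Λ) ≤
              C₀ * Θ ^ (m / 2) * (P.Klam * U) ^ (m / 2 - 1) * (2 : ℝ) ^ ((3 * (m / 2) - 5) * (n - 2)) *
                (((2 : ℝ) ^ (n - 2))⁻¹) ^ levelGainExp (levelCount Ωe)) ∧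
          (∀ m : ℕ, ¬ Even m → ∀ Ωe : Fin m → Option (SectorLeg (sectorCount (n - 2) + 4)),
            hubbardSectorKernelNorm L M β (pointAugment (klAnisoFamily L M β μ (klFlowFrameU L M β U μ n) klE0 (n - 2)) (klE5ExtMomenta Qm x y)) (prescribedTuples univ Ωe) (klE5Carrier L M β μ (klFlowFrameU L M β U μ n) (n - 1) (klE5Kappa L M β U μ (klFlowFrameU L M β U μ n) (n - 1)) (klE5Input L M β U μ (klFlowFrameU L M β U μ n) (n - 1)) Λ) ≤ 0) ∧
          α ≤ (klScale klE0 (n - 1) - klScale klE0 n) * (Cα * (imagTimeWeight β M)⁻¹ * (16 : ℝ) ^ n / klE0 ^ 2))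
    (h12 : ∃ u : EngConsts → ℝ → ℝ, (∀ Q cc, 0 < u Q cc) ∧
        ∀ G : GeoConsts, G.WF → ∀ Q : EngConsts, (klEngQ7 P R).IsRaiseOf Q →
        ∀ cc : ℝ, 0 < cc → cc ≤ klEngC₃6 P R →
        ∀ μ ∈ klWindowC, ∀ U : ℝ, 0 < U → U ≤ klEngU₀10 P R cc → U ≤ u Q cc →
        ∀ β : ℝ, klBetaMin ≤ β → β ≤ Real.exp (cc / U ^ 2) →
        ∀ (L M : ℕ) [NeZero L] [NeZero M], klEngL₄ P R β U ≤ L → klEngM₃ β U L ≤ M →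
        ∀ n : ℕ, 1 ≤ n → n ≤ nScales β + 1 → IsKLRegime U cc (-(n : ℤ)) →
        HistP klPredsV17F2 L M G P Q R β U μ 0 n →
        FrameOK R U (nScales β) μ (klFlowFrameU L M β U μ n) →
        (∀ j ≤ n, LevelsUExportMixedAt L M (klCU2 P R (klEngQ7 P R)) P β U μ j) →
        ∀ Λ ∈ Set.Icc (klScale klE0 n) (klScale klE0 (n - 1)), ∀ Qm : TorusSite 2 L,
        ∀ x y : TorusSite 2 L × MatsubaraIdx M, x.1 ∈ klBall L μ 0 → y.1 ∈ klBall L μ 0 →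
        n ≤ 2 →
        ∃ (α κ₀ δ κ₁ x' A : ℝ) (Nf Ne : ℕ → ℕ → ℝ), 0 ≤ α ∧ 0 ≤ κ₀ ∧ 0 ≤ δ ∧ 0 ≤ κ₁ ∧
          (∀ X, ∑ Y, ‖((sectorSubMatrix L M β (trivialMultiplier L M)).transpose *
            normalCovariance L M (fun ks => ((klScale klE0 (n - 1) - klScale klE0 n : ℝ) : ℂ) * klE5DerivLineSym L M β μ (klFlowFrameU L M β U μ n) (n - 1) (klE5Kappa L M β U μ (klFlowFrameU L M β U μ n) (n - 1)) Λ ks) *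
            sectorSubMatrix L M β (trivialMultiplier L M)) X Y‖ ≤ α) ∧
          (∀ Y, ∑ X, ‖((sectorSubMatrix L M β (trivialMultiplier L M)).transpose *
            normalCovariance L M (fun ks => ((klScale klE0 (n - 1) - klScale klE0 n : ℝ) : ℂ) * klE5DerivLineSym L M β μ (klFlowFrameU L M β U μ n) (n - 1) (klE5Kappa L M β U μ (klFlowFrameU L M β U μ n) (n - 1)) Λ ks) *
            sectorSubMatrix L M β (trivialMultiplier L M)) X Y‖ ≤ α) ∧
          (∀ Y : SpaceTimeIdx L M × SectorLeg 1, Y.2.2 = 0 →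
            ‖sectorGramF L M β (trivialMultiplier L M) (fun ks => ((klScale klE0 (n - 1) - klScale klE0 n : ℝ) : ℂ) * klE5DerivLineSym L M β μ (klFlowFrameU L M β U μ n) (n - 1) (klE5Kappa L M β U μ (klFlowFrameU L M β U μ n) (n - 1)) Λ ks) Y‖ ≤ κ₀) ∧
          (∀ Y : SpaceTimeIdx L M × SectorLeg 1, Y.2.2 = 1 →
            ‖sectorGramG L M β (trivialMultiplier L M) (fun ks => ((klScale klE0 (n - 1) - klScale klE0 n : ℝ) : ℂ) * klE5DerivLineSym L M β μ (klFlowFrameU L M β U μ n) (n - 1) (klE5Kappa L M β U μ (klFlowFrameU L M β U μ n) (n - 1)) Λ ks) Y‖ ≤ κ₀) ∧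
          (∀ X Y, ‖((sectorSubMatrix L M β (trivialMultiplier L M)).transpose * normalCovariance L M (klE5SoftLineSym L M β μ (klFlowFrameU L M β U μ n) (n - 1) (klE5Kappa L M β U μ (klFlowFrameU L M β U μ n) (n - 1)) Λ) *
            sectorSubMatrix L M β (trivialMultiplier L M)) X Y‖ ≤ δ) ∧
          (∀ Y : SpaceTimeIdx L M × SectorLeg 1, Y.2.2 = 0 → ‖sectorGramF L M β (trivialMultiplier L M) (klE5SoftLineSym L M β μ (klFlowFrameU L M β U μ n) (n - 1) (klE5Kappa L M β U μ (klFlowFrameU L M β U μ n) (n - 1)) Λ) Y‖ ≤ κ₁) ∧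
          (∀ Y : SpaceTimeIdx L M × SectorLeg 1, Y.2.2 = 1 → ‖sectorGramG L M β (trivialMultiplier L M) (klE5SoftLineSym L M β μ (klFlowFrameU L M β U μ n) (n - 1) (klE5Kappa L M β U μ (klFlowFrameU L M β U μ n) (n - 1)) Λ) Y‖ ≤ κ₁) ∧
          (∀ k q, 0 ≤ Ne k q) ∧
          (∀ k ∈ Icc 3 (Fintype.card (HubbardFieldIdx L M × Fin 2) + 2), ∀ q ≤ 4, ∀ σ : Fin q → SectorLeg 1,
            hubbardSectorKernelNorm L M β (trivialMultiplier L M) (prescribedTuples univ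
              (Fin.append (fun _ : Fin k => (none : Option (SectorLeg 1))) (fun j => some (σ j)))) (klE5Carrier L M β μ (klFlowFrameU L M β U μ n) (n - 1) (klE5Kappa L M β U μ (klFlowFrameU L M β U μ n) (n - 1)) (klE5Input L M β U μ (klFlowFrameU L M β U μ n) (n - 1)) Λ) ≤ Nf k q) ∧
          (∀ k ∈ Icc 3 (Fintype.card (HubbardFieldIdx L M × Fin 2) + 2), ∀ q ≤ 4, ∀ (τ : Fin 3 → SectorLeg 1) (σ : Fin q → SectorLeg 1),
            hubbardSectorKernelNorm L M β (trivialMultiplier L M) (prescribedTuples univ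
              (Fin.append (fun i : Fin k => if h : (i : ℕ) < 3 then some (τ ⟨i, h⟩) else none) (fun j => some (σ j))))
              (klE5Carrier L M β μ (klFlowFrameU L M β U μ n) (n - 1) (klE5Kappa L M β U μ (klFlowFrameU L M β U μ n) (n - 1)) (klE5Input L M β U μ (klFlowFrameU L M β U μ n) (n - 1)) Λ) ≤ Ne k q) ∧
          0 ≤ x' ∧ x' ≤ 1 / 2 ∧ 0 ≤ A ∧
          (∀ q ∈ Icc 1 4, ∀ k ∈ Icc 3 (Fintype.card (HubbardFieldIdx L M × Fin 2) + 2),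
            (κ₀ ^ 2 + κ₁ ^ 2) ^ (k - 3) * ((imagTimeWeight β M * Nf k q) * (imagTimeWeight β M * Ne k (4 - q))) ≤ x' ^ (k - 3) * A) ∧
          α ≤ (klScale klE0 (n - 1) - klScale klE0 n) * (Cα * (imagTimeWeight β M)⁻¹ * (16 : ℝ) ^ n / klE0 ^ 2) ∧
          δ ≤ Cδ * klE0 * ((8 : ℝ) ^ n)⁻¹ ∧ A ≤ CA * imagTimeWeight β M ^ 2 * (P.Klam * U) ^ 3 * (8 : ℝ) ^ n) :
    E5ShareStep2 P R (klE5Raise2 P R) (klE5ShareU2 P R) :=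
  e5ShareStep2_klE5Raise2_of_exists (exists_e5Pkg2_of_stepDataRows P R hP hR hCα hC₀ hΘ hCA hKlam h3 h12)

end Rows

end Summit.HubbardSuperconductivity.HubbardSuperconductivity.Theorems.KLRegimeSplit

end
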